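import Summits.QuantumFields.YangMills.Theorems.BalabanUVNodesN21ThresholdMixtureTStepChi
import Literature.MathematicalPhysics.QuantumFieldTheory.Balaban1983to89.Node00.StepWeightsOfRecord

/-!
# YM-DAG node N21 (= NE7c) — THE THRESHOLD MIXTURE, PART 7b: def-T's LABEL WEIGHTS OF RECORD (the 𝐓-step's pinned (3.2)·(3.3) factors,
# `Node00/StepWeightsOfRecord`) MADE THRESHOLD-PARAMETRIC — sharp mixed-polarity slot products at the diagonal, unity and pinned-cube sums at
# every threshold vector, the common-box average as the (η)-profiled label weight

Track A of `YM-PLAN.md` (cell `pub-ymgap`, HUMAN RULING D-0062), node **N21**; R141 (C) fan-out seat `pub-ymgap-dag-n21-e` (s3 = ALTERNATIVE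
CURRENCY), generation 5, file 14b.  Companions: file 14a `…N21ThresholdMixtureTStepChi` (the (3.2)∕(3.3) characteristic functions of r11's
`B14Sect3Decomp` as per-cube-threshold mixed-polarity sharp products; common-box averages), files 13a∕13b (the (2.17) front factor), def-T's
`Lit/…/Node00/StepWeightsOfRecord.lean` (the label weights of record `ω s t = a(P)·b(P,Q)·ζ(R,S)`), dag-n20-c's module 17
`…N20LCSLargeFieldLabels` (p492349: the pinned-cube label sums AT THE RECORD's threshold — the diagonal of §3 below).  Kernel bookkeeping: 0 `def`,
0 `sorry`, standard axioms.  COUNT-NEUTRAL; `--supports` the K3‴ item `SpineGivenEndpointR13` (stmt-QuantumFields-19912) as a helper.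

WHAT THIS FILE DOES.  def-T pins the 𝐓-step's decompositions of unity at the record: the (3.2) label weight `aWeight s P V′ = [P ⊆ cubes32 s]·χ_{k+1}(cubes32∖P)·
χᶜ_{k+1}(P)` and the (3.3) label weight `bWeight A₁ s P Q U V′ = [Q ⊆ qcubes s P]·χ′_k(qcubes∖Q)·χ′ᶜ_k(Q)` (thresholds `ε_{k+1}η_{k+1}²` and `2δ_k` FIXED inside).
§1 reads both as the DIAGONAL of a per-cube-threshold mixed-polarity SHARP product in the K5 readings' letters (`(pol).fac (smallInd u s)`): the (3.2) factor
of record `chiFactor` is `smallInd` of 13a's block-sup; `aWeight` (on its range) is the sharp product over `cubes32 s` with polarity «large on `P`»; `bWeight`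
(on its range) is the sharp product over `qcubes s P` at 14a's bond-sup tested variable with polarity «large on `Q`»; and ★ `a·b` is ONE sharp product over the
occurrence list `cubes32 s ⊕ qcubes s P` read at the diagonal threshold vector — the `hXs` letter of the K5 readings (10b∕11b) for the 𝐓-step's pinned factors,
the residual `ζ(R,S)` (and front factor, density) being the threshold-free remainder.  §2 ★ the normalised COMMON-BOX average (ONE multiplier per occurrence
`x : Iχ ⊕ Iχ` of the step, unread coordinates cancelling) of that threshold-parametric product IS design (η)'s PROFILED label weight
`∏ (pol x).fac (linProfile κ_x (u_x∕θ_x))`, pointwise and against any integrable remainder under any s-finite law of the two fields (14a §1).  §3 the label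
STRUCTURE of record at EVERY threshold vector: decomposition of unity over `(P,Q)` and over `(P,Q,R,S)` given ζ's displayed unity (def-T's `IsZetaUnity`;
diagonal = def-T's `labelUnity_ωOfRecord`) — the E1∕E2 input of file 12's `classSum_eq_of_sharpCommonBox` —, and the PINNED-CUBE class sums `Σ_{P ∋ c} a_S(P)
= [c ∈ cubes32 s]·(1 − smallInd (u_c) (S_c))`, `Σ_{Q ∋ c} b_S(P,Q) = [c ∈ qcubes s P]·(1 − smallInd (u′_c) (S_c))` (diagonal = dag-n20-c's `sum_aWeight_filter_mem` ∕
`sum_bWeight_filter_mem`) — N20's `hbad` shape UNIFORM over the common box.  §4 the `meas` binder of the (3.3) slots from def-T's displayed (O4).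

HONEST FRAMING.  NE7c is NOT PRINTED and NOT PROVED.  Currency only: the threshold vector is an explicit ARGUMENT of inline products (no new definition, no
`…Cube` rider); the values at the diagonal are def-T's definitions (§1 are `rfl`-level identities through 14a).  The residual `ζ_{k+1}(R,S)` ((3.16)∕(3.20)∕(3.21):
small-fluctuation characteristic functions of the fluctuation field, `ZetaOfRecord` abstract — no body in the tree) is LOCATED and untouched: its own occurrences
are not yet sharp slots of anything typed.  The mixture is design, NOT print verbatim; nothing of Bałaban's is asserted; N21 NOT discharged; count-neutral; one
finite four-torus programme at fixed `ε`; NOT continuum ∕ ℝ⁴ ∕ OS ∕ mass gap ∕ Clay.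

CITATION HEADER (lean-in-tree rule 2026-08-18).  BY NAME: def-T `Node00.chiFactor` ∕ `sect3DataOfRecord` ∕ `cubes32` ∕ `qcubes` ∕ `aWeight` ∕ `bWeight` ∕
`deltaOfRecord` ∕ `IsZetaUnity` ∕ `LbOfRecord` ([Balaban1988Convergent] (3.2)–(3.5) p. 265, (3.16) p. 268, (3.20)–(3.21) p. 269, typed there with locators);
14a `chiNext_sdiff_mul_chiNextc_eq_prod_fac` ∕ `chiPrime_sdiff_mul_chiPrimec_eq_prod_fac` ∕ `commonBox_average_prod_fac_smallInd_eq` ∕ `commonBox_average_facWeight_eq` ∕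
`sum_ite_subset_prod_smallInd_eq_one` ∕ `sum_ite_mem_prod_smallInd_eq` ∕ `measurable_iSup_dist1_bond`; 13a `chiSmall_eq_smallInd_iSup` ∕ `measurable_iSup_dist1`;
dag-n20-c `N20LCSLargeFieldLabels.sum_aWeight_filter_mem` ∕ `sum_bWeight_filter_mem` (the diagonal, cited not restated).  Context only (SHAPE):
[Balaban1988Convergent] (3.2)–(3.3) p. 265.

WHAT IS PROVED ([folklore] unless cited).  §1 `chiFactor_eq_smallInd_iSup` · ★ `aWeight_eq_prod_fac_smallInd` · ★ `bWeight_eq_prod_fac_smallInd` ·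
★★ `aWeight_mul_bWeight_eq_prod_fac_disjSum`; §2 ★★ `commonBox_average_tStepLabel_eq_profile` · `commonBox_average_tStepWeight_eq_profile`; §3 `sum_tStepLabel_eq_one` ·
`sum_tStepLabel_zeta_eq_one` · `sum_filter_mem_tStepLabelA_eq` · `sum_filter_mem_tStepLabelB_eq`; §4 `measurable_tStepStat32` · `measurable_tStepStat33`.
-/

set_option autoImplicit false

noncomputable section

open MeasureTheory Set
open scoped BigOperators ENNReal

namespace Summit.QuantumFields.YangMills.Theorems.N21ThresholdMixtureTStepChiAtRecord

open Literature.MathematicalPhysics.QuantumFieldTheory.Balaban1983to89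
open Literature.MathematicalPhysics.QuantumFieldTheory.Balaban1983to89.T4Continuum
open Literature.MathematicalPhysics.QuantumFieldTheory.Balaban1983to89.T4IndicatorShell
open Literature.MathematicalPhysics.QuantumFieldTheory.Balaban1983to89.T4LipschitzCutoff
open Literature.MathematicalPhysics.QuantumFieldTheory.Balaban1983to89.T4LipschitzLedger
open Literature.MathematicalPhysics.QuantumFieldTheory.Balaban1983to89.Node00
open B14.Sect3Decomp
open Summit.QuantumFields.YangMills.Theorems.N21ThresholdMixtureRecordChi (chiSmall_eq_smallInd_iSup measurable_iSup_dist1)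
open Summit.QuantumFields.YangMills.Theorems.N21ThresholdMixtureTStepChi

variable (F : T4Family) (N : ℕ) [NeZero N] (ν : Stage7Numerics) (M : ℕ) (p : B12.RunParams) (g : ℕ → ℝ) (k : ℕ)

/-! ## §1 The label weights of record are diagonals of per-cube-threshold mixed-polarity sharp products -/

section Diagonal

/-- **THE (3.2) FACTOR OF RECORD IS `smallInd` OF THE BLOCK-SUP.**  For `0 < ε_{k+1}η_{k+1}²`: def-T's `chiFactor … c V′ = smallInd (u_c(V′)) (ε_{k+1}η_{k+1}²)` with the
threshold-free tested variable `u_c(V′) = ⨆_{p ⊂ □′^∼} dist1 (U_{k+1,□′}(V′)(∂p))` — 13a's `chiSmall_eq_smallInd_iSup` at def-R's pins one level up (the letters are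
those of `sect3DataOfRecord … s` for any `s`: `plaqT`, `UkLoc` do not depend on the sequence). [cite: Balaban1988Convergent, (3.2) p.265, (2.16)–(2.17) p.257] -/
theorem chiFactor_eq_smallInd_iSup (hε : 0 < epsOfRecord ν g (k + 1) * (F.P p.K).eta (k + 1) ^ 2) (s : SeqOfRecord F ν M g p.K k)
    (c : Iχ F ν p g k) (V' : GaugeField (F.P p.K) (k + 1) (SU N)) :
    chiFactor F N ν p g k c V' =
      smallInd (⨆ q : ↥((sect3DataOfRecord F N ν M p g k s).plaqT c),
        dist1 (GaugeField.plaqHol ((sect3DataOfRecord F N ν M p g k s).UkLoc c V') q.1))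
        (epsOfRecord ν g (k + 1) * (F.P p.K).eta (k + 1) ^ 2) :=
  chiSmall_eq_smallInd_iSup (Or.inr hε) _

/-- ★ **THE (3.2) LABEL WEIGHT OF RECORD IS THE DIAGONAL OF A SHARP MIXED PRODUCT.**  For `P ⊆ cubes32 s` (the (3.2) range `(Z̃_k^{∼4})ᶜ`) and `0 < ε_{k+1}η_{k+1}²`:
`aWeight s P V′ = ∏_{□′ ∈ cubes32 s} (if □′ ∈ P then large else small).fac (smallInd (u_{□′}(V′)) (ε_{k+1}η_{k+1}²))` — every cube of the range ONE slot with its own threshold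
coordinate, read at the constant vector. (Off the range `aWeight = 0` by definition.) [cite: Balaban1988Convergent, (3.2) p.265] -/
theorem aWeight_eq_prod_fac_smallInd (hε : 0 < epsOfRecord ν g (k + 1) * (F.P p.K).eta (k + 1) ^ 2) (s : SeqOfRecord F ν M g p.K k)
    {Pl : Finset (Iχ F ν p g k)} (hPl : Pl ⊆ cubes32 F ν M p g k s) (V' : GaugeField (F.P p.K) (k + 1) (SU N)) :
    aWeight F N ν M p g k s Pl V' =
      ∏ c ∈ cubes32 F ν M p g k s, (if c ∈ Pl then Pol.large else Pol.small).fac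
        (smallInd (⨆ q : ↥((sect3DataOfRecord F N ν M p g k s).plaqT c),
          dist1 (GaugeField.plaqHol ((sect3DataOfRecord F N ν M p g k s).UkLoc c V') q.1))
          (epsOfRecord ν g (k + 1) * (F.P p.K).eta (k + 1) ^ 2)) := by
  unfold aWeight
  rw [if_pos hPl]
  exact chiNext_sdiff_mul_chiNextc_eq_prod_fac (sect3DataOfRecord F N ν M p g k s) hε hPl V'

/-- ★ **THE (3.3) LABEL WEIGHT OF RECORD IS THE DIAGONAL OF A SHARP MIXED PRODUCT.**  For `Q ⊆ qcubes s P` (the (3.3) range `(B^{k+1}(P¹_{k+1}))^{∼−1}`) and `0 < 2δ_k`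
(`δ_k = g_kA₁∕(A₀p₀(g_k))`): `bWeight A₁ s P Q U V′ = ∏_{□′ ∈ qcubes s P} (if □′ ∈ Q then large else small).fac (smallInd (u′_{□′}(U, V′)) (2δ_k))` with 14a's bond-sup
tested variable `u′_{□′}(U,V′) = ⨆_{b ∈ (□′^{∼2})^{(k)*}} dist1 (U(b)·(V^{(k)}_{□′}(V′)(b))⁻¹)` of the pinned data. [cite: Balaban1988Convergent, (3.3)–(3.4) p.265] -/
theorem bWeight_eq_prod_fac_smallInd (A₁ : ℝ) (hδ : 0 < 2 * deltaOfRecord ν g k A₁) (s : SeqOfRecord F ν M g p.K k)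
    (Pl : Finset (Iχ F ν p g k)) {Ql : Finset (Iχ F ν p g k)} (hQl : Ql ⊆ qcubes F ν M p g k s Pl)
    (U : GaugeField (F.P p.K) k (SU N)) (V' : GaugeField (F.P p.K) (k + 1) (SU N)) :
    bWeight F N ν M p g k A₁ s Pl Ql U V' =
      ∏ c ∈ qcubes F ν M p g k s Pl, (if c ∈ Ql then Pol.large else Pol.small).fac
        (smallInd (⨆ b : ↥((sect3DataOfRecord F N ν M p g k s).bondsStar c),
          dist1 (U b.1 * (Vbox (sect3DataOfRecord F N ν M p g k s) (avOfRecord F N p.K) c V' b.1)⁻¹))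
          (2 * deltaOfRecord ν g k A₁)) := by
  unfold bWeight
  rw [if_pos hQl]
  exact chiPrime_sdiff_mul_chiPrimec_eq_prod_fac (sect3DataOfRecord F N ν M p g k s) (avOfRecord F N p.K) hδ hQl U V'

/-- ★★ **THE PINNED (3.2)·(3.3) PART OF THE LABEL WEIGHT IS ONE SHARP PRODUCT OVER THE 𝐓-STEP's OCCURRENCE LIST, READ AT THE DIAGONAL.**  For a label with
`P ⊆ cubes32 s`, `Q ⊆ qcubes s P`, `0 < ε_{k+1}η_{k+1}²`, `0 < 2δ_k`: `aWeight s P V′ · bWeight A₁ s P Q U V′ = ∏_{x ∈ cubes32 s ⊕ qcubes s P} (pol x).fac (smallInd (u x) (S x))`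
with occurrences `x : Iχ ⊕ Iχ` ((3.2)-tests `inl □′` on `V′`, (3.3)-tests `inr □′` on `(U, V′)`), polarities «large on the label», the threshold-free tested variables of §1,
and the DIAGONAL threshold vector `S = Sum.elim (· ↦ ε_{k+1}η_{k+1}²) (· ↦ 2δ_k)` — the `hXs` letter of the K5 readings for def-T's `ωOfRecord = a·b·ζ`, the residual `ζ(R,S)`
being the threshold-free remainder. [cite: Balaban1988Convergent, (3.2)–(3.5) p.265] -/
theorem aWeight_mul_bWeight_eq_prod_fac_disjSum (hε : 0 < epsOfRecord ν g (k + 1) * (F.P p.K).eta (k + 1) ^ 2) (A₁ : ℝ)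
    (hδ : 0 < 2 * deltaOfRecord ν g k A₁) (s : SeqOfRecord F ν M g p.K k) {Pl Ql : Finset (Iχ F ν p g k)}
    (hPl : Pl ⊆ cubes32 F ν M p g k s) (hQl : Ql ⊆ qcubes F ν M p g k s Pl)
    (U : GaugeField (F.P p.K) k (SU N)) (V' : GaugeField (F.P p.K) (k + 1) (SU N)) :
    aWeight F N ν M p g k s Pl V' * bWeight F N ν M p g k A₁ s Pl Ql U V' =
      ∏ x ∈ (cubes32 F ν M p g k s).disjSum (qcubes F ν M p g k s Pl),
        (Sum.elim (fun c => if c ∈ Pl then Pol.large else Pol.small) (fun c => if c ∈ Ql then Pol.large else Pol.small) x).fac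
          (smallInd
            (Sum.elim
              (fun c => ⨆ q : ↥((sect3DataOfRecord F N ν M p g k s).plaqT c),
                dist1 (GaugeField.plaqHol ((sect3DataOfRecord F N ν M p g k s).UkLoc c V') q.1))
              (fun c => ⨆ b : ↥((sect3DataOfRecord F N ν M p g k s).bondsStar c),
                dist1 (U b.1 * (Vbox (sect3DataOfRecord F N ν M p g k s) (avOfRecord F N p.K) c V' b.1)⁻¹)) x)
            (Sum.elim (fun _ => epsOfRecord ν g (k + 1) * (F.P p.K).eta (k + 1) ^ 2) (fun _ => 2 * deltaOfRecord ν g k A₁) x)) := by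
  rw [Finset.prod_disjSum, aWeight_eq_prod_fac_smallInd F N ν M p g k hε s hPl V',
    bWeight_eq_prod_fac_smallInd F N ν M p g k A₁ hδ s Pl hQl U V']
  rfl

end Diagonal

/-! ## §2 The common-box average of the threshold-parametric label product is the (η)-profiled label weight -/

section CommonBox

/-- ★★ **(η)'s PROFILED 𝐓-STEP LABEL WEIGHT IS THE COMMON-BOX AVERAGE OF PRINT's SHARP ONE.**  One threshold coordinate per occurrence `x : Iχ ⊕ Iχ` of the step
(ALL χ_{k+1}-cubes, both tests), window `[(1 − κ_x)θ_x, θ_x]` with `θ = Sum.elim (· ↦ ε_{k+1}η_{k+1}²) (· ↦ 2δ_k)` (`0 < κ_x`, both thresholds positive); the label `(P,Q)` reads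
the sub-family `cubes32 s ⊕ qcubes s P`.  The normalised average over this common box of the per-occurrence-threshold sharp product of §1 — whose value at `S ≡ θ` IS
`aWeight·bWeight` (`aWeight_mul_bWeight_eq_prod_fac_disjSum`) — equals `∏_{x} (pol x).fac (linProfile κ_x (u_x ∕ θ_x))`: design (η)'s Lipschitz-profiled (3.2)·(3.3) label
weight at the SAME objects (14a's `commonBox_average_prod_fac_smallInd_eq` at `ι := Iχ ⊕ Iχ`). [cite: Balaban1988Convergent, (3.2)–(3.3) p.265] -/
theorem commonBox_average_tStepLabel_eq_profile (hε : 0 < epsOfRecord ν g (k + 1) * (F.P p.K).eta (k + 1) ^ 2) (A₁ : ℝ)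
    (hδ : 0 < 2 * deltaOfRecord ν g k A₁) (s : SeqOfRecord F ν M g p.K k) (Pl Ql : Finset (Iχ F ν p g k))
    (κ : Iχ F ν p g k ⊕ Iχ F ν p g k → ℝ) (hκ : ∀ x, 0 < κ x)
    (U : GaugeField (F.P p.K) k (SU N)) (V' : GaugeField (F.P p.K) (k + 1) (SU N)) :
    (∏ x : Iχ F ν p g k ⊕ Iχ F ν p g k,
        (κ x * Sum.elim (fun _ => epsOfRecord ν g (k + 1) * (F.P p.K).eta (k + 1) ^ 2) (fun _ => 2 * deltaOfRecord ν g k A₁) x))⁻¹ *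
      ∫ S, ∏ x ∈ (cubes32 F ν M p g k s).disjSum (qcubes F ν M p g k s Pl),
          (Sum.elim (fun c => if c ∈ Pl then Pol.large else Pol.small) (fun c => if c ∈ Ql then Pol.large else Pol.small) x).fac
            (smallInd
              (Sum.elim
                (fun c => ⨆ q : ↥((sect3DataOfRecord F N ν M p g k s).plaqT c),
                  dist1 (GaugeField.plaqHol ((sect3DataOfRecord F N ν M p g k s).UkLoc c V') q.1))
                (fun c => ⨆ b : ↥((sect3DataOfRecord F N ν M p g k s).bondsStar c),
                  dist1 (U b.1 * (Vbox (sect3DataOfRecord F N ν M p g k s) (avOfRecord F N p.K) c V' b.1)⁻¹)) x)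
              (S x))
        ∂(Measure.pi fun x => volume.restrict
          (Icc ((1 - κ x) * Sum.elim (fun _ => epsOfRecord ν g (k + 1) * (F.P p.K).eta (k + 1) ^ 2)
              (fun _ => 2 * deltaOfRecord ν g k A₁) x)
            (Sum.elim (fun _ => epsOfRecord ν g (k + 1) * (F.P p.K).eta (k + 1) ^ 2) (fun _ => 2 * deltaOfRecord ν g k A₁) x))) =
      ∏ x ∈ (cubes32 F ν M p g k s).disjSum (qcubes F ν M p g k s Pl),
        (Sum.elim (fun c => if c ∈ Pl then Pol.large else Pol.small) (fun c => if c ∈ Ql then Pol.large else Pol.small) x).fac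
          (linProfile (κ x)
            (Sum.elim
                (fun c => ⨆ q : ↥((sect3DataOfRecord F N ν M p g k s).plaqT c),
                  dist1 (GaugeField.plaqHol ((sect3DataOfRecord F N ν M p g k s).UkLoc c V') q.1))
                (fun c => ⨆ b : ↥((sect3DataOfRecord F N ν M p g k s).bondsStar c),
                  dist1 (U b.1 * (Vbox (sect3DataOfRecord F N ν M p g k s) (avOfRecord F N p.K) c V' b.1)⁻¹)) x /
              Sum.elim (fun _ => epsOfRecord ν g (k + 1) * (F.P p.K).eta (k + 1) ^ 2) (fun _ => 2 * deltaOfRecord ν g k A₁) x)) :=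
  commonBox_average_prod_fac_smallInd_eq _ _ κ _ _ hκ fun x => by
    cases x with
    | inl _ => exact hε
    | inr _ => exact hδ

/-- **… AND AGAINST ANY REMAINDER** (the `hXs`∕`hA` pair of the K5 readings for the 𝐓-step's pinned factors).  Under any s-finite law `μ` of the two fields
`z = (V′, U)` (def-T's order) and any integrable remainder `R` (print: the residual `ζ(R,S)` times front factor and density), with the (3.2)∕(3.3) tested variables
measurable in `z` — DISPLAYED (def-T's (O4); §4 derives them from the measurability of the pinned background maps) —, the normalised common-box average of the SHARP
weight `∫ (∏_x (pol x).fac 1[u_x(z) < S_x]) R(z) dμ` is the PROFILED weight `∫ (∏_x (pol x).fac (linProfile κ_x (u_x(z)∕θ_x))) R(z) dμ` (14a's `commonBox_average_facWeight_eq`,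
one Fubini swap). [cite: Balaban1988Convergent, (3.2)–(3.3) p.265] -/
theorem commonBox_average_tStepWeight_eq_profile (hε : 0 < epsOfRecord ν g (k + 1) * (F.P p.K).eta (k + 1) ^ 2) (A₁ : ℝ)
    (hδ : 0 < 2 * deltaOfRecord ν g k A₁) (s : SeqOfRecord F ν M g p.K k) (Pl Ql : Finset (Iχ F ν p g k))
    (κ : Iχ F ν p g k ⊕ Iχ F ν p g k → ℝ) (hκ : ∀ x, 0 < κ x)
    (μ : Measure (GaugeField (F.P p.K) (k + 1) (SU N) × GaugeField (F.P p.K) k (SU N))) [SFinite μ]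
    {R : GaugeField (F.P p.K) (k + 1) (SU N) × GaugeField (F.P p.K) k (SU N) → ℝ} (hR : Integrable R μ)
    (hmeas : ∀ x ∈ (cubes32 F ν M p g k s).disjSum (qcubes F ν M p g k s Pl),
      Measurable fun z : GaugeField (F.P p.K) (k + 1) (SU N) × GaugeField (F.P p.K) k (SU N) =>
        Sum.elim
          (fun c => ⨆ q : ↥((sect3DataOfRecord F N ν M p g k s).plaqT c),
            dist1 (GaugeField.plaqHol ((sect3DataOfRecord F N ν M p g k s).UkLoc c z.1) q.1))
          (fun c => ⨆ b : ↥((sect3DataOfRecord F N ν M p g k s).bondsStar c),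
            dist1 (z.2 b.1 * (Vbox (sect3DataOfRecord F N ν M p g k s) (avOfRecord F N p.K) c z.1 b.1)⁻¹)) x) :
    (∏ x : Iχ F ν p g k ⊕ Iχ F ν p g k,
        (κ x * Sum.elim (fun _ => epsOfRecord ν g (k + 1) * (F.P p.K).eta (k + 1) ^ 2) (fun _ => 2 * deltaOfRecord ν g k A₁) x))⁻¹ *
      ∫ S, (∫ z, (∏ x ∈ (cubes32 F ν M p g k s).disjSum (qcubes F ν M p g k s Pl),
          (Sum.elim (fun c => if c ∈ Pl then Pol.large else Pol.small) (fun c => if c ∈ Ql then Pol.large else Pol.small) x).fac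
            (smallInd
              (Sum.elim
                (fun c => ⨆ q : ↥((sect3DataOfRecord F N ν M p g k s).plaqT c),
                  dist1 (GaugeField.plaqHol ((sect3DataOfRecord F N ν M p g k s).UkLoc c z.1) q.1))
                (fun c => ⨆ b : ↥((sect3DataOfRecord F N ν M p g k s).bondsStar c),
                  dist1 (z.2 b.1 * (Vbox (sect3DataOfRecord F N ν M p g k s) (avOfRecord F N p.K) c z.1 b.1)⁻¹)) x)
              (S x))) * R z ∂μ)
        ∂(Measure.pi fun x => volume.restrict
          (Icc ((1 - κ x) * Sum.elim (fun _ => epsOfRecord ν g (k + 1) * (F.P p.K).eta (k + 1) ^ 2)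
              (fun _ => 2 * deltaOfRecord ν g k A₁) x)
            (Sum.elim (fun _ => epsOfRecord ν g (k + 1) * (F.P p.K).eta (k + 1) ^ 2) (fun _ => 2 * deltaOfRecord ν g k A₁) x))) =
      ∫ z, (∏ x ∈ (cubes32 F ν M p g k s).disjSum (qcubes F ν M p g k s Pl),
        (Sum.elim (fun c => if c ∈ Pl then Pol.large else Pol.small) (fun c => if c ∈ Ql then Pol.large else Pol.small) x).fac
          (linProfile (κ x)
            (Sum.elim
                (fun c => ⨆ q : ↥((sect3DataOfRecord F N ν M p g k s).plaqT c),
                  dist1 (GaugeField.plaqHol ((sect3DataOfRecord F N ν M p g k s).UkLoc c z.1) q.1))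
                (fun c => ⨆ b : ↥((sect3DataOfRecord F N ν M p g k s).bondsStar c),
                  dist1 (z.2 b.1 * (Vbox (sect3DataOfRecord F N ν M p g k s) (avOfRecord F N p.K) c z.1 b.1)⁻¹)) x /
              Sum.elim (fun _ => epsOfRecord ν g (k + 1) * (F.P p.K).eta (k + 1) ^ 2) (fun _ => 2 * deltaOfRecord ν g k A₁) x))) * R z ∂μ :=
  commonBox_average_facWeight_eq μ _ _ κ _
    (u := fun x z => Sum.elim
      (fun c => ⨆ q : ↥((sect3DataOfRecord F N ν M p g k s).plaqT c),
        dist1 (GaugeField.plaqHol ((sect3DataOfRecord F N ν M p g k s).UkLoc c z.1) q.1))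
      (fun c => ⨆ b : ↥((sect3DataOfRecord F N ν M p g k s).bondsStar c),
        dist1 (z.2 b.1 * (Vbox (sect3DataOfRecord F N ν M p g k s) (avOfRecord F N p.K) c z.1 b.1)⁻¹)) x)
    hmeas hR hκ fun x => by
      cases x with
      | inl _ => exact hε
      | inr _ => exact hδ

end CommonBox

/-! ## §3 The label structure of record at every threshold vector: unity and the pinned-cube class sums -/

section Structure

/-- **THE (3.2)·(3.3) LABEL STRUCTURE OF RECORD RESOLVES UNITY AT EVERY THRESHOLD VECTOR.**  For ANY tested values `u, u′ : Iχ → ℝ` and ANY threshold vectors `S, S′`: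
`Σ_P Σ_Q [P ⊆ cubes32 s](∏_{cubes32 s∖P} 1[u < S])(∏_P (1 − 1[u < S])) · [Q ⊆ qcubes s P](∏_{qcubes s P∖Q} 1[u′ < S′])(∏_Q (1 − 1[u′ < S′])) = 1` — r11's `eq32` ∘ `eq33` off the diagonal
(14a's `sum_ite_subset_prod_smallInd_eq_one` twice); the «sharp decomposition of unity at every threshold assignment» of file 12's `classSum_eq_of_sharpCommonBox` for the
𝐓-step's pinned labels. [cite: Balaban1988Convergent, (3.2)–(3.3) p.265] -/
theorem sum_tStepLabel_eq_one (s : SeqOfRecord F ν M g p.K k) (u u' S S' : Iχ F ν p g k → ℝ) :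
    (∑ Pl : Finset (Iχ F ν p g k), ∑ Ql : Finset (Iχ F ν p g k),
      (if Pl ⊆ cubes32 F ν M p g k s then
          (∏ c ∈ cubes32 F ν M p g k s \ Pl, smallInd (u c) (S c)) * ∏ c ∈ Pl, (1 - smallInd (u c) (S c)) else 0) *
        (if Ql ⊆ qcubes F ν M p g k s Pl then
          (∏ c ∈ qcubes F ν M p g k s Pl \ Ql, smallInd (u' c) (S' c)) * ∏ c ∈ Ql, (1 - smallInd (u' c) (S' c)) else 0)) = 1 := by
  simp_rw [← Finset.mul_sum, sum_ite_subset_prod_smallInd_eq_one, mul_one]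
  exact sum_ite_subset_prod_smallInd_eq_one _ u S

omit [NeZero N] in
/-- **… AND WITH THE RESIDUAL, over the full label type `(P,Q,R,S)_{k+1}`**, given ζ's displayed unity (def-T's `IsZetaUnity`): at every pair of threshold vectors the
(3.2)·(3.3)·ζ label weights sum to `1` — def-T's `labelUnity_ωOfRecord` being the diagonal (front factor absorbed there). [cite: Balaban1988Convergent, (3.2)–(3.5) p.265, (3.16) p.268, (3.20)–(3.21) p.269] -/
theorem sum_tStepLabel_zeta_eq_one {ζ : ZetaOfRecord F N ν M} (hζ : IsZetaUnity F N ν M ζ) (s : SeqOfRecord F ν M g p.K k)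
    (u u' S S' : Iχ F ν p g k → ℝ) (U : GaugeField (F.P p.K) k (SU N)) (V' : GaugeField (F.P p.K) (k + 1) (SU N)) :
    (∑ t : LbOfRecord F ν p g k,
      (if t.1 ⊆ cubes32 F ν M p g k s then
          (∏ c ∈ cubes32 F ν M p g k s \ t.1, smallInd (u c) (S c)) * ∏ c ∈ t.1, (1 - smallInd (u c) (S c)) else 0) *
        ((if t.2.1 ⊆ qcubes F ν M p g k s t.1 then
            (∏ c ∈ qcubes F ν M p g k s t.1 \ t.2.1, smallInd (u' c) (S' c)) * ∏ c ∈ t.2.1, (1 - smallInd (u' c) (S' c)) else 0) *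
          ζ p g k s t.1 t.2.1 t.2.2 U V')) = 1 := by
  have hz : ∀ Pl Ql : Finset (Iχ F ν p g k), ∑ R, ∑ S₁, ζ p g k s Pl Ql (R, S₁) U V' = 1 := fun Pl Ql => by
    rw [← hζ p g k s Pl Ql U V', Fintype.sum_prod_type]
  calc (∑ t : LbOfRecord F ν p g k,
      (if t.1 ⊆ cubes32 F ν M p g k s then
          (∏ c ∈ cubes32 F ν M p g k s \ t.1, smallInd (u c) (S c)) * ∏ c ∈ t.1, (1 - smallInd (u c) (S c)) else 0) *
        ((if t.2.1 ⊆ qcubes F ν M p g k s t.1 then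
            (∏ c ∈ qcubes F ν M p g k s t.1 \ t.2.1, smallInd (u' c) (S' c)) * ∏ c ∈ t.2.1, (1 - smallInd (u' c) (S' c)) else 0) *
          ζ p g k s t.1 t.2.1 t.2.2 U V'))
      = ∑ Pl, ∑ Ql, ∑ R, ∑ S₁,
          (if Pl ⊆ cubes32 F ν M p g k s then
              (∏ c ∈ cubes32 F ν M p g k s \ Pl, smallInd (u c) (S c)) * ∏ c ∈ Pl, (1 - smallInd (u c) (S c)) else 0) *
            ((if Ql ⊆ qcubes F ν M p g k s Pl then
                (∏ c ∈ qcubes F ν M p g k s Pl \ Ql, smallInd (u' c) (S' c)) * ∏ c ∈ Ql, (1 - smallInd (u' c) (S' c)) else 0) *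
              ζ p g k s Pl Ql (R, S₁) U V') := by
        simp only [Fintype.sum_prod_type]
    _ = ∑ Pl, (if Pl ⊆ cubes32 F ν M p g k s then
              (∏ c ∈ cubes32 F ν M p g k s \ Pl, smallInd (u c) (S c)) * ∏ c ∈ Pl, (1 - smallInd (u c) (S c)) else 0) *
          ∑ Ql, (if Ql ⊆ qcubes F ν M p g k s Pl then
              (∏ c ∈ qcubes F ν M p g k s Pl \ Ql, smallInd (u' c) (S' c)) * ∏ c ∈ Ql, (1 - smallInd (u' c) (S' c)) else 0) *
            ∑ R, ∑ S₁, ζ p g k s Pl Ql (R, S₁) U V' := by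
        simp only [Finset.mul_sum]
    _ = 1 := by
        simp only [hz, mul_one, sum_ite_subset_prod_smallInd_eq_one]

/-- **N20's PINNED-CUBE (3.2) CLASS SUM AT EVERY THRESHOLD VECTOR** (dag-n20-c's `sum_aWeight_filter_mem` being the diagonal `S ≡ ε_{k+1}η_{k+1}²`): the labels with `c ∈ P`
carry total threshold-parametric a-weight `[c ∈ cubes32 s]·(1 − 1[u_c < S_c])` — the cube's OWN large-field factor at its OWN threshold coordinate, for every `S` in the
common box: the `hbad` shape of file 12's `relWeightBound_of_sharpCommonBox`, uniform over the box. [cite: Balaban1988Convergent, (3.2) p.265] -/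
theorem sum_filter_mem_tStepLabelA_eq (s : SeqOfRecord F ν M g p.K k) (u S : Iχ F ν p g k → ℝ) (c : Iχ F ν p g k) :
    (∑ Pl ∈ Finset.univ.filter (fun Pl : Finset (Iχ F ν p g k) => c ∈ Pl),
      (if Pl ⊆ cubes32 F ν M p g k s then
        (∏ c' ∈ cubes32 F ν M p g k s \ Pl, smallInd (u c') (S c')) * ∏ c' ∈ Pl, (1 - smallInd (u c') (S c')) else 0)) =
      if c ∈ cubes32 F ν M p g k s then 1 - smallInd (u c) (S c) else 0 := by
  rw [Finset.sum_filter]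
  exact sum_ite_mem_prod_smallInd_eq _ u S c

/-- **N20's PINNED-CUBE (3.3) CLASS SUM AT EVERY THRESHOLD VECTOR** (dag-n20-c's `sum_bWeight_filter_mem` being the diagonal `S′ ≡ 2δ_k`): for every `P`, the labels with
`c ∈ Q` carry total threshold-parametric b-weight `[c ∈ qcubes s P]·(1 − 1[u′_c < S′_c])`. [cite: Balaban1988Convergent, (3.3) p.265] -/
theorem sum_filter_mem_tStepLabelB_eq (s : SeqOfRecord F ν M g p.K k) (Pl : Finset (Iχ F ν p g k)) (u' S' : Iχ F ν p g k → ℝ)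
    (c : Iχ F ν p g k) :
    (∑ Ql ∈ Finset.univ.filter (fun Ql : Finset (Iχ F ν p g k) => c ∈ Ql),
      (if Ql ⊆ qcubes F ν M p g k s Pl then
        (∏ c' ∈ qcubes F ν M p g k s Pl \ Ql, smallInd (u' c') (S' c')) * ∏ c' ∈ Ql, (1 - smallInd (u' c') (S' c')) else 0)) =
      if c ∈ qcubes F ν M p g k s Pl then 1 - smallInd (u' c) (S' c) else 0 := by
  rw [Finset.sum_filter]
  exact sum_ite_mem_prod_smallInd_eq _ u' S' c

end Structure

/-! ## §4 The `meas` binder of the 𝐓-step's slots from def-T's displayed (O4) -/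

section Meas

/-- **THE (3.2) TESTED VARIABLE IS MEASURABLE IN `(V′, U)`** if the pinned localized background `V′ ↦ U_{k+1,□′}(V′)` is (def-T's (O4) ∕ K0b's (H-U) one level up, DISPLAYED):
13a's `measurable_iSup_dist1` along the first coordinate. [cite: Balaban1988Convergent, (3.2) p.265, (2.16) p.257 (bookkeeping)] -/
theorem measurable_tStepStat32 (s : SeqOfRecord F ν M g p.K k) (c : Iχ F ν p g k)
    (hU : Measurable fun V' : GaugeField (F.P p.K) (k + 1) (SU N) => (sect3DataOfRecord F N ν M p g k s).UkLoc c V') :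
    Measurable fun z : GaugeField (F.P p.K) (k + 1) (SU N) × GaugeField (F.P p.K) k (SU N) =>
      ⨆ q : ↥((sect3DataOfRecord F N ν M p g k s).plaqT c),
        dist1 (GaugeField.plaqHol ((sect3DataOfRecord F N ν M p g k s).UkLoc c z.1) q.1) :=
  ((measurable_iSup_dist1 _).comp hU).comp measurable_fst

/-- **THE (3.3) TESTED VARIABLE IS MEASURABLE IN `(V′, U)`** if the pinned k-fold average of the localized background `V′ ↦ V^{(k)}_{□′}(V′) = M^k(U_{k+1,□′}(V′))` is
(def-T's (O4), DISPLAYED): 14a's `measurable_iSup_dist1_bond` with `U` the second coordinate (`RegularGaugeGroup (SU N)`: `dist1`, `·⁻¹`, `·*·` measurable).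
[cite: Balaban1988Convergent, (3.3)–(3.4) p.265 (bookkeeping)] -/
theorem measurable_tStepStat33 (s : SeqOfRecord F ν M g p.K k) (c : Iχ F ν p g k)
    (hVb : Measurable fun V' : GaugeField (F.P p.K) (k + 1) (SU N) =>
      Vbox (sect3DataOfRecord F N ν M p g k s) (avOfRecord F N p.K) c V') :
    Measurable fun z : GaugeField (F.P p.K) (k + 1) (SU N) × GaugeField (F.P p.K) k (SU N) =>
      ⨆ b : ↥((sect3DataOfRecord F N ν M p g k s).bondsStar c),
        dist1 (z.2 b.1 * (Vbox (sect3DataOfRecord F N ν M p g k s) (avOfRecord F N p.K) c z.1 b.1)⁻¹) :=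
  measurable_iSup_dist1_bond (sect3DataOfRecord F N ν M p g k s) (avOfRecord F N p.K) c
    (Vk := fun z : GaugeField (F.P p.K) (k + 1) (SU N) × GaugeField (F.P p.K) k (SU N) => z.2)
    (V := fun z => z.1) measurable_snd (hVb.comp measurable_fst)

end Meas

end Summit.QuantumFields.YangMills.Theorems.N21ThresholdMixtureTStepChiAtRecord

end
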